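import Literature.Geometry.Lorentzian.CarterFluxEnvelopes
import HarnessLib

/-!
# The `𝓘⁺`-envelope of Carter's equation restarted at a κ-free radius (far side of a thick barrier)
(namespace `Literature.Geometry.Lorentzian.Kerr`.)

Carter's radial equation `u″ + φ u = 0`, `φ = ω² − V∘ρ` (`V = Kerr.sepPotential M a ω m Λ`, `ρ` a
tortoise radius; DRSR arXiv:1402.7034 §5.2.3). `CarterFluxEnvelopes.carter_envelope_I` bounds the
infinity-normalised solution (`‖u‖ → 1`, `‖u′‖ → |ω|` at `+∞`) on `[Z, ∞)` when `φ ≥ 0` there, the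
near-zone start `Z` being tied to the flux-regime horizon zone `ρ Z ≥ r₊ + σ²M³/(416Λ)` so that the
tortoise length of `[Z, x₇]` (`ρ x₇ = 7M`) is `≤ (25/κ)·log(2496Λ/(σ²M²))`. In the THRESHOLD CONE of
the near-extremal programme (`σ = ω − mω₊ → 0`, Breitenlohner–Freedman stable sectors) the barrier ends
at a radius `ρ b₂ ≥ r₊ + ζ` a κ-FREE distance `ζ ≍ θ₁r₊` beyond the horizon
(`CarterThresholdBarrier.lean`), and the right tool is the same envelope restarted THERE:

* `IsTortoiseRadius.sub_le_mul_inv_sub` — κ-FREE near-zone tortoise length: for `x ≤ y` with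
  `ρ y ≤ 7M`, `y − x ≤ 50M²·(1/(ρ x − r₊) − 1/(ρ y − r₊)) ≤ 50M²/(ρ x − r₊)`
  (`d/dx[−1/(ρ − r₊)] = (ρ − r₋)/((ρ − r₊)(ρ² + a²)) ≥ 1/(50M²)`);
* `carter_etaEnergy_I_le_of_far_start` — for the `𝓘⁺`-data solution, `Z < x₇`, `ρ Z ≥ r₊ + ζ`
  (`ζ > 0`), `0 < η`, `η² ≤ Φ`, `φ ≤ Φ` everywhere and `φ ≥ 0` on `[Z, ∞)`: on `[Z, x₇]`,
  `η²‖u‖² + ‖u′‖² ≤ B_ζ := (Φ/η²)^16 · exp(2η·50M²/ζ) · (η²(2 + 2|ω|R)² + 2ω²)`,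
  `R = max(7M, √(12Λ)/|ω|, 1/(Mω²))`;
* `carter_envelope_I_of_far_start`, `carter_envelope_I_deriv_of_far_start` — for all `s ≥ Z`:
  `‖u s‖² ≤ (2 + 2|ω|R)² + B_ζ/η²` and `‖u′ s‖² ≤ 2ω² + B_ζ`.

With `η = ζ/(50M²) ∧ …` the exponential is `e²` and every factor is a polynomial in `(Λ, |ω|, |ω|⁻¹,
M, M⁻¹, ζ⁻¹)` — NO `κ` and NO `σ` enter (gap G2 of the BF-stable large-`Λ` kernel bound, crux
`KappaExplicitWaveDecay`). Not here: where the barrier ends (that is the census,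
`Kerr.forbidden_interval(_threshold)`).

## References
* M. Dafermos, I. Rodnianski, Y. Shlapentokh-Rothman, arXiv:1402.7034 = Ann. of Math. 183 (2016),
  §§2.1.2, 5.2.3, 8 (key `DafermosRodnianskiShlapentokhrothman2014`). The assembly is folklore.
-/

noncomputable section

open Filter Set
open scoped _root_.Topology

namespace Literature.Geometry.Lorentzian

namespace Kerr

/-! ### κ-free near-zone tortoise length -/

namespace IsTortoiseRadius

variable {M a : ℝ} {ρ : ℝ → ℝ}

-- adapted from Literature/Geometry/Lorentzian/KerrTortoiseZones.lean (`sub_le_mul_log_div`)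
/-- **κ-free near-zone tortoise length.** For a tortoise radius `ρ` of a sub-extremal Kerr exterior and
`x ≤ y` with `ρ y ≤ 7M`: `y − x ≤ 50M²·((ρ x − r₊)⁻¹ − (ρ y − r₊)⁻¹)` — the function
`−(ρ − r₊)⁻¹ − s/(50M²)` is non-decreasing, since `dρ/ds = (ρ − r₊)(ρ − r₋)/(ρ² + a²) ≥ (ρ − r₊)²/(50M²)`
while `ρ ≤ 7M`. [cite: DafermosRodnianskiShlapentokhrothman2014, §2.1.2] -/
theorem sub_le_mul_inv_sub (hρ : IsTortoiseRadius M a ρ) (hMa : IsSubextremal M a) {x y : ℝ}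
    (hxy : x ≤ y) (hy : ρ y ≤ 7 * M) :
    y - x ≤ 50 * M ^ 2 * ((ρ x - rPlus M a)⁻¹ - (ρ y - rPlus M a)⁻¹) := by
  have hM : 0 < M := hMa.pos
  have haM : |a| ≤ M := le_of_lt hMa
  have ha2 : a ^ 2 ≤ M ^ 2 := by nlinarith [sq_abs a, abs_nonneg a]
  set g : ℝ → ℝ := fun s ↦ -(ρ s - rPlus M a)⁻¹ - s / (50 * M ^ 2) with hg
  have hderiv : ∀ s, HasDerivAt g
      ((ρ s - rMinus M a) / ((ρ s - rPlus M a) * (ρ s ^ 2 + a ^ 2)) - 1 / (50 * M ^ 2)) s := by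
    intro s
    have hpos : 0 < ρ s - rPlus M a := sub_pos.2 (hρ.rPlus_lt s)
    have hA : 0 < ρ s ^ 2 + a ^ 2 := hρ.sq_add_sq_pos hMa s
    have h1 : HasDerivAt (fun s ↦ ρ s - rPlus M a) (delta M a (ρ s) / (ρ s ^ 2 + a ^ 2)) s :=
      (hρ.hasDerivAt s).sub_const _
    have h2 := (h1.inv hpos.ne').neg
    have e : -(-(delta M a (ρ s) / (ρ s ^ 2 + a ^ 2)) / (ρ s - rPlus M a) ^ 2) =
        (ρ s - rMinus M a) / ((ρ s - rPlus M a) * (ρ s ^ 2 + a ^ 2)) := by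
      rw [delta_eq_mul haM]
      field_simp
    rw [e] at h2
    exact h2.sub ((hasDerivAt_id s).div_const (50 * M ^ 2) |>.congr_deriv (by simp))
  have hmono : MonotoneOn g (Icc x y) := by
    refine monotoneOn_of_hasDerivWithinAt_nonneg (convex_Icc x y)
      (fun s _ ↦ (hderiv s).continuousAt.continuousWithinAt)
      (fun s _ ↦ (hderiv s).hasDerivWithinAt) fun s hs ↦ ?_
    rw [interior_Icc] at hs
    have hs7 : ρ s ≤ 7 * M := ((hρ.strictMono hMa).monotone hs.2.le).trans hy
    have hpos : 0 < ρ s - rPlus M a := sub_pos.2 (hρ.rPlus_lt s)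
    have h0 : 0 < ρ s := hρ.pos hMa s
    have hA : 0 < ρ s ^ 2 + a ^ 2 := hρ.sq_add_sq_pos hMa s
    have hle1 : ρ s - rPlus M a ≤ ρ s - rMinus M a := by linarith [rMinus_le_rPlus M a]
    have hle2 : ρ s ^ 2 + a ^ 2 ≤ 50 * M ^ 2 := by nlinarith
    rw [sub_nonneg, div_le_div_iff₀ (by positivity) (mul_pos hpos hA), one_mul]
    calc (ρ s - rPlus M a) * (ρ s ^ 2 + a ^ 2) ≤ (ρ s - rMinus M a) * (50 * M ^ 2) :=
          mul_le_mul hle1 hle2 hA.le (by linarith)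
      _ = (ρ s - rMinus M a) * (50 * M ^ 2) := rfl
  have hgxy : g x ≤ g y := hmono (left_mem_Icc.2 hxy) (right_mem_Icc.2 hxy) hxy
  simp only [hg] at hgxy
  have hM2 : 0 < 50 * M ^ 2 := by positivity
  have e1 : y - x = 50 * M ^ 2 * (y / (50 * M ^ 2) - x / (50 * M ^ 2)) := by field_simp
  rw [e1]
  exact mul_le_mul_of_nonneg_left (by linarith) hM2.le

/-- **κ-free near-zone tortoise length, one-sided form**: for `x ≤ y` with `ρ y ≤ 7M`,
`y − x ≤ 50M²/(ρ x − r₊)`. [cite: DafermosRodnianskiShlapentokhrothman2014, §2.1.2] -/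
theorem sub_le_div_sub_rPlus (hρ : IsTortoiseRadius M a ρ) (hMa : IsSubextremal M a) {x y : ℝ}
    (hxy : x ≤ y) (hy : ρ y ≤ 7 * M) : y - x ≤ 50 * M ^ 2 / (ρ x - rPlus M a) := by
  have h := hρ.sub_le_mul_inv_sub hMa hxy hy
  have hy0 : 0 ≤ (ρ y - rPlus M a)⁻¹ := inv_nonneg.2 (sub_nonneg.2 (hρ.rPlus_lt y).le)
  have hM2 : 0 ≤ 50 * M ^ 2 := by positivity
  calc y - x ≤ 50 * M ^ 2 * ((ρ x - rPlus M a)⁻¹ - (ρ y - rPlus M a)⁻¹) := h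
    _ ≤ 50 * M ^ 2 * (ρ x - rPlus M a)⁻¹ := by
        apply mul_le_mul_of_nonneg_left _ hM2; linarith
    _ = 50 * M ^ 2 / (ρ x - rPlus M a) := (div_eq_mul_inv _ _).symm

end IsTortoiseRadius

/-! ### The `𝓘⁺`-envelope restarted at a κ-free radius -/

section Envelopes

variable {M a ω Λ : ℝ} {m : ℤ} {ρ : ℝ → ℝ} {u u₁ : ℝ → ℂ}

-- adapted from Literature/Geometry/Lorentzian/CarterFluxEnvelopes.lean (`carter_etaEnergy_I_le`)
/-- **`η`-energy of the `𝓘⁺`-data solution on a near zone with κ-free start.** Let `ρ x₇ = 7M`,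
`Z < x₇` with `ρ Z ≥ r₊ + ζ` (`ζ > 0`), `ω ≠ 0`, `0 < η`, `η² ≤ Φ`, `ω² − V∘ρ ≤ Φ` everywhere and
`ω² − V∘ρ ≥ 0` on `[Z, ∞)`. Then for `s ∈ [Z, x₇]`:
`η²‖u s‖² + ‖u′ s‖² ≤ (Φ/η²)^16 · exp(2η·50M²/ζ) · (η²(2 + 2|ω|R)² + 2ω²)`,
`R = max(7M, √(12Λ)/|ω|, 1/(Mω²))`. [folklore] -/
theorem carter_etaEnergy_I_le_of_far_start (hρ : IsTortoiseRadius M a ρ) (hMa : IsSubextremal M a)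
    (hadm : IsAdmissibleTriple a ω m Λ) (hω : ω ≠ 0)
    (hu : ∀ x, HasDerivAt u (u₁ x) x ∧
      HasDerivAt u₁ (-(((ω ^ 2 - sepPotential M a ω m Λ (ρ x) : ℝ) : ℂ) * u x)) x)
    (hlim : Tendsto (fun x ↦ ‖u x‖) atTop (𝓝 1)) (hlim₁ : Tendsto (fun x ↦ ‖u₁ x‖) atTop (𝓝 |ω|))
    {Z x₇ η Φ ζ : ℝ} (hx₇ : ρ x₇ = 7 * M) (hZx₇ : Z < x₇) (hζ : 0 < ζ) (hZ : rPlus M a + ζ ≤ ρ Z)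
    (hη : 0 < η) (hηΦ : η ^ 2 ≤ Φ) (hΦ : ∀ s, ω ^ 2 - sepPotential M a ω m Λ (ρ s) ≤ Φ)
    (hpos : ∀ s, Z ≤ s → 0 ≤ ω ^ 2 - sepPotential M a ω m Λ (ρ s)) {s : ℝ} (hs : s ∈ Icc Z x₇) :
    η ^ 2 * ‖u s‖ ^ 2 + ‖u₁ s‖ ^ 2 ≤
      (Φ / η ^ 2) ^ 16 * Real.exp (2 * η * (50 * M ^ 2 / ζ)) *
        (η ^ 2 * (2 + 2 * |ω| * max (7 * M) (max (Real.sqrt (12 * Λ) / |ω|) (1 / (M * ω ^ 2)))) ^ 2 +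
          2 * ω ^ 2) := by
  set R := max (7 * M) (max (Real.sqrt (12 * Λ) / |ω|) (1 / (M * ω ^ 2))) with hR
  have hM : 0 < M := hMa.pos
  have hx₇' : 7 * M ≤ ρ x₇ := hx₇.ge
  -- data at `x₇`
  have hfar : ‖u x₇‖ ≤ 2 + 2 * |ω| * R :=
    carter_far_norm_le hρ hMa hω hadm hu hlim hlim₁ hx₇' (fun t ht ↦ hpos t (hZx₇.le.trans ht))
  have hder : ‖u₁ x₇‖ ≤ Real.sqrt 2 * |ω| :=
    carter_far_norm_deriv_le hρ hMa hadm hu hlim hlim₁ hx₇' (hpos x₇ hZx₇.le)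
  have hE7 : η ^ 2 * ‖u x₇‖ ^ 2 + ‖u₁ x₇‖ ^ 2 ≤ η ^ 2 * (2 + 2 * |ω| * R) ^ 2 + 2 * ω ^ 2 := by
    have h1 : ‖u x₇‖ ^ 2 ≤ (2 + 2 * |ω| * R) ^ 2 := pow_le_pow_left₀ (norm_nonneg _) hfar 2
    have h2 : ‖u₁ x₇‖ ^ 2 ≤ (Real.sqrt 2 * |ω|) ^ 2 := pow_le_pow_left₀ (norm_nonneg _) hder 2
    have e : (Real.sqrt 2 * |ω|) ^ 2 = 2 * ω ^ 2 := by
      rw [mul_pow, Real.sq_sqrt (by norm_num : (0 : ℝ) ≤ 2), sq_abs]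
    rw [e] at h2
    nlinarith [sq_nonneg η]
  -- transport on `[Z, x₇]`
  have hzone : ∀ t ∈ Icc Z x₇, -η ^ 2 ≤ ω ^ 2 - sepPotential M a ω m Λ (ρ t) ∧
      ω ^ 2 - sepPotential M a ω m Λ (ρ t) ≤ Φ := fun t ht ↦
    ⟨le_trans (by nlinarith [sq_nonneg η]) (hpos t ht.1), hΦ t⟩
  have key := carter_tameZone_transport hρ hMa hadm hu hZx₇ hη hηΦ hzone (x := x₇) (y := s)
    (right_mem_Icc.2 hZx₇.le) hs
  -- κ-free length of `[Z, x₇]`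
  have hlen : x₇ - Z ≤ 50 * M ^ 2 / ζ := by
    have h1 : x₇ - Z ≤ 50 * M ^ 2 / (ρ Z - rPlus M a) :=
      hρ.sub_le_div_sub_rPlus hMa hZx₇.le (by rw [hx₇])
    have h2 : 50 * M ^ 2 / (ρ Z - rPlus M a) ≤ 50 * M ^ 2 / ζ :=
      div_le_div_of_nonneg_left (by positivity) hζ (by linarith)
    exact h1.trans h2
  have hexp : Real.exp (2 * η * (x₇ - Z)) ≤ Real.exp (2 * η * (50 * M ^ 2 / ζ)) :=
    Real.exp_le_exp.2 (mul_le_mul_of_nonneg_left hlen (by positivity))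
  calc η ^ 2 * ‖u s‖ ^ 2 + ‖u₁ s‖ ^ 2
      ≤ (Φ / η ^ 2) ^ 16 * Real.exp (2 * η * (x₇ - Z)) * (η ^ 2 * ‖u x₇‖ ^ 2 + ‖u₁ x₇‖ ^ 2) := key
    _ ≤ (Φ / η ^ 2) ^ 16 * Real.exp (2 * η * (50 * M ^ 2 / ζ)) *
        (η ^ 2 * (2 + 2 * |ω| * R) ^ 2 + 2 * ω ^ 2) := by
        have h0 : 0 ≤ (Φ / η ^ 2) ^ 16 := by
          have : 0 ≤ Φ / η ^ 2 := div_nonneg ((sq_nonneg η).trans hηΦ) (sq_nonneg η)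
          positivity
        gcongr

-- adapted from Literature/Geometry/Lorentzian/CarterFluxEnvelopes.lean (`carter_envelope_I`)
/-- **Envelope of the `𝓘⁺`-data solution beyond a κ-free start `Z`** (far zone by the far envelope,
near zone by `carter_etaEnergy_I_le_of_far_start`): for all `s ≥ Z`,
`‖u s‖² ≤ (2 + 2|ω|R)² + B_ζ/η²`, `B_ζ = (Φ/η²)^16 · exp(2η·50M²/ζ) · (η²(2 + 2|ω|R)² + 2ω²)`.
Hypotheses as in `carter_etaEnergy_I_le_of_far_start`, except that `Z < x₇` may fail (then only the
far zone occurs). [folklore] -/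
theorem carter_envelope_I_of_far_start (hρ : IsTortoiseRadius M a ρ) (hMa : IsSubextremal M a)
    (hadm : IsAdmissibleTriple a ω m Λ) (hω : ω ≠ 0)
    (hu : ∀ x, HasDerivAt u (u₁ x) x ∧
      HasDerivAt u₁ (-(((ω ^ 2 - sepPotential M a ω m Λ (ρ x) : ℝ) : ℂ) * u x)) x)
    (hlim : Tendsto (fun x ↦ ‖u x‖) atTop (𝓝 1)) (hlim₁ : Tendsto (fun x ↦ ‖u₁ x‖) atTop (𝓝 |ω|))
    {Z x₇ η Φ ζ : ℝ} (hx₇ : ρ x₇ = 7 * M) (hζ : 0 < ζ) (hZ : rPlus M a + ζ ≤ ρ Z)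
    (hη : 0 < η) (hηΦ : η ^ 2 ≤ Φ) (hΦ : ∀ s, ω ^ 2 - sepPotential M a ω m Λ (ρ s) ≤ Φ)
    (hpos : ∀ s, Z ≤ s → 0 ≤ ω ^ 2 - sepPotential M a ω m Λ (ρ s)) {s : ℝ} (hs : Z ≤ s) :
    ‖u s‖ ^ 2 ≤
      (2 + 2 * |ω| * max (7 * M) (max (Real.sqrt (12 * Λ) / |ω|) (1 / (M * ω ^ 2)))) ^ 2 +
      (Φ / η ^ 2) ^ 16 * Real.exp (2 * η * (50 * M ^ 2 / ζ)) *
        (η ^ 2 * (2 + 2 * |ω| * max (7 * M) (max (Real.sqrt (12 * Λ) / |ω|) (1 / (M * ω ^ 2)))) ^ 2 +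
          2 * ω ^ 2) / η ^ 2 := by
  set R := max (7 * M) (max (Real.sqrt (12 * Λ) / |ω|) (1 / (M * ω ^ 2))) with hR
  set Ba := (Φ / η ^ 2) ^ 16 * Real.exp (2 * η * (50 * M ^ 2 / ζ)) *
        (η ^ 2 * (2 + 2 * |ω| * R) ^ 2 + 2 * ω ^ 2) with hBa
  have hBa0 : 0 ≤ Ba := by
    have : 0 ≤ Φ / η ^ 2 := div_nonneg ((sq_nonneg η).trans hηΦ) (sq_nonneg η)
    positivity
  rcases le_or_gt (7 * M) (ρ s) with h7 | h7
  · -- far zone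
    have hfar : ‖u s‖ ≤ 2 + 2 * |ω| * R :=
      carter_far_norm_le hρ hMa hω hadm hu hlim hlim₁ h7 (fun t ht ↦ hpos t (hs.trans ht))
    have h1 : ‖u s‖ ^ 2 ≤ (2 + 2 * |ω| * R) ^ 2 := pow_le_pow_left₀ (norm_nonneg _) hfar 2
    have h2 : 0 ≤ Ba / η ^ 2 := by positivity
    linarith
  · -- near zone `[Z, x₇]`
    have hsx₇ : s < x₇ := by rw [← hρ.lt_iff_lt hMa, hx₇]; exact h7
    have hZx₇ : Z < x₇ := lt_of_le_of_lt hs hsx₇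
    have key := carter_etaEnergy_I_le_of_far_start hρ hMa hadm hω hu hlim hlim₁ hx₇ hZx₇ hζ hZ hη hηΦ
      hΦ hpos (s := s) ⟨hs, hsx₇.le⟩
    have hη2 : 0 < η ^ 2 := by positivity
    have h1 : ‖u s‖ ^ 2 ≤ Ba / η ^ 2 := by
      rw [le_div_iff₀ hη2]
      have : η ^ 2 * ‖u s‖ ^ 2 ≤ Ba := le_trans (le_add_of_nonneg_right (sq_nonneg _)) key
      linarith
    have h0 : 0 ≤ (2 + 2 * |ω| * R) ^ 2 := sq_nonneg _
    linarith

/-- **Derivative envelope of the `𝓘⁺`-data solution beyond a κ-free start `Z`**: under the hypotheses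
of `carter_envelope_I_of_far_start`, for all `s ≥ Z`: `‖u′ s‖² ≤ 2ω² + B_ζ` (far zone:
`carter_far_norm_deriv_le`; near zone: the `η`-energy bound). [folklore] -/
theorem carter_envelope_I_deriv_of_far_start (hρ : IsTortoiseRadius M a ρ) (hMa : IsSubextremal M a)
    (hadm : IsAdmissibleTriple a ω m Λ) (hω : ω ≠ 0)
    (hu : ∀ x, HasDerivAt u (u₁ x) x ∧
      HasDerivAt u₁ (-(((ω ^ 2 - sepPotential M a ω m Λ (ρ x) : ℝ) : ℂ) * u x)) x)
    (hlim : Tendsto (fun x ↦ ‖u x‖) atTop (𝓝 1)) (hlim₁ : Tendsto (fun x ↦ ‖u₁ x‖) atTop (𝓝 |ω|))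
    {Z x₇ η Φ ζ : ℝ} (hx₇ : ρ x₇ = 7 * M) (hζ : 0 < ζ) (hZ : rPlus M a + ζ ≤ ρ Z)
    (hη : 0 < η) (hηΦ : η ^ 2 ≤ Φ) (hΦ : ∀ s, ω ^ 2 - sepPotential M a ω m Λ (ρ s) ≤ Φ)
    (hpos : ∀ s, Z ≤ s → 0 ≤ ω ^ 2 - sepPotential M a ω m Λ (ρ s)) {s : ℝ} (hs : Z ≤ s) :
    ‖u₁ s‖ ^ 2 ≤ 2 * ω ^ 2 +
      (Φ / η ^ 2) ^ 16 * Real.exp (2 * η * (50 * M ^ 2 / ζ)) *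
        (η ^ 2 * (2 + 2 * |ω| * max (7 * M) (max (Real.sqrt (12 * Λ) / |ω|) (1 / (M * ω ^ 2)))) ^ 2 +
          2 * ω ^ 2) := by
  set R := max (7 * M) (max (Real.sqrt (12 * Λ) / |ω|) (1 / (M * ω ^ 2))) with hR
  set Ba := (Φ / η ^ 2) ^ 16 * Real.exp (2 * η * (50 * M ^ 2 / ζ)) *
        (η ^ 2 * (2 + 2 * |ω| * R) ^ 2 + 2 * ω ^ 2) with hBa
  have hBa0 : 0 ≤ Ba := by
    have : 0 ≤ Φ / η ^ 2 := div_nonneg ((sq_nonneg η).trans hηΦ) (sq_nonneg η)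
    positivity
  rcases le_or_gt (7 * M) (ρ s) with h7 | h7
  · have hder : ‖u₁ s‖ ≤ Real.sqrt 2 * |ω| :=
      carter_far_norm_deriv_le hρ hMa hadm hu hlim hlim₁ h7 (hpos s hs)
    have h2 : ‖u₁ s‖ ^ 2 ≤ (Real.sqrt 2 * |ω|) ^ 2 := pow_le_pow_left₀ (norm_nonneg _) hder 2
    have e : (Real.sqrt 2 * |ω|) ^ 2 = 2 * ω ^ 2 := by
      rw [mul_pow, Real.sq_sqrt (by norm_num : (0 : ℝ) ≤ 2), sq_abs]
    rw [e] at h2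
    linarith
  · have hsx₇ : s < x₇ := by rw [← hρ.lt_iff_lt hMa, hx₇]; exact h7
    have hZx₇ : Z < x₇ := lt_of_le_of_lt hs hsx₇
    have key := carter_etaEnergy_I_le_of_far_start hρ hMa hadm hω hu hlim hlim₁ hx₇ hZx₇ hζ hZ hη hηΦ
      hΦ hpos (s := s) ⟨hs, hsx₇.le⟩
    have h1 : ‖u₁ s‖ ^ 2 ≤ Ba := le_trans (le_add_of_nonneg_left (by positivity)) key
    have : 0 ≤ 2 * ω ^ 2 := by positivity
    linarith

end Envelopes

end Kerr

end Literature.Geometry.Lorentzian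

end
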